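import Summits.ResolutionOfSingularities.ResolutionOfSingularities.Theorems.WildLogDiagonalLU4
import HarnessLib

/-!
# WildLogDiagonalLU5 — PART D: the CONTROL CERTIFICATE (`lucas_mod_five`, `five_not_dvd_lucas`, `control_not_lucky`), the located residual R33 `NonKHToricArchLUKeyHenselDescentQuotTInertTwoMBWildLD`, the exact cuts `R32 ↔ R33 ↔ … ↔ R23`, ROOT BY NAME `closes_logDiag`

One of the five landing files of the g32 node «LogDiagonalCut» of the ROOT/RESIDUAL decomposition cell `decomp-res`
(lens 1; door (W-wild-PROD) of NEXT-g32, critic letters 229a / 229b, ROW 234; files `WildLogDiagonalLU`, `…LU2`,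
`…LU3`, `…LU4`, `…LU5`); see the module docstring of `Summits.ResolutionOfSingularities.ResolutionOfSingularities.Theorems.WildLogDiagonalLU`
for the thesis (the binomial log-diagonal wild `ℤ/p` cell decided hypothesis-free by PRODUCTION of the pseudo-reflection
model — toric chart + Frobenius normal form + Nakayama + derivation rule — then the g31 law / [KiralyLutkebohmert2013,
Thm. 2] BY NAME), the cell `WildLogDiagonalLUAbove k O` and the law `relLU_of_wildLogDiagonalLUAbove` (in `…LU4`), the
toy census, the instances, the control certificate and the typed complement kinds, the honest scope and the sources.
This file: the control lemmas, `not_wildLogDiagonalLUAbove_of_not_wildPseudoReflectionLUAbove` / `…_of_not_unramifiedWitnessLUAbove` (honest scope), the cell piece `…MBWildLDCell` (+ `_holds`), R33, `…WildLD_of_wild`, the cuts `_iff_logDiag`, `…WildLD_of_root`, `closes_logDiag` (EXACTLY `closes_mb`'s binders with `R32 ↦ R33`), `root_iff_logDiag_sigma`.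
Imports: the slice `…WildLogDiagonalLU4` (R32, `closes_wild`, `root_iff_wild_sigma` come from the landed `…WildReflectionLU3`).  Problem side, sorry-free, hypothesis-free (zero fact binders); every heavy theorem carries
`set_option maxHeartbeats … in` BEFORE its docstring — keep it.
-/

noncomputable section

open Literature.AlgebraicGeometry.Resolution
open Summit.ResolutionOfSingularities.ResolutionOfSingularities.Theorems.InertDescentLU
open Summit.ResolutionOfSingularities.ResolutionOfSingularities.Theorems.InvariantDescentLU
open Summit.ResolutionOfSingularities.ResolutionOfSingularities.Theorems.WildReflectionLU

universe u

namespace Summit.ResolutionOfSingularities.ResolutionOfSingularities.Theorems.WildLogDiagonalLU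

variable {E : Type u} [Field E]

/-! ## PART D — CONTROL CERTIFICATE, the located residual `R33`, the exact cuts `R32 ↔ R33 ↔ … ↔ R23`, ROOT BY NAME -/

section Control

/-- **LUCKINESS IS NECESSARY FOR THE MECHANISM (kernel half of the control): two coordinates with twists prime to
`p` are never lucky.**  On a monomial chart of a binomial log-diagonal top the augmentation ideal is the MONOMIAL
ideal `(x′_j η^{p^{v_p N_j}})_j` (Frobenius normal form), principal iff one generator divides the others; with two
twists prime to `p` neither of `x′_{j₁} η`, `x′_{j₂} η` divides the other. [folklore] -/
theorem not_lucky_of_not_dvd_two (p : ℕ) {d : ℕ} {N : Fin d → ℤ} (a' : Fin d → ℕ) {j₁ j₂ : Fin d}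
    (hne : j₁ ≠ j₂) (h₁ : ¬ (p : ℤ) ∣ N j₁) (h₂ : ¬ (p : ℤ) ∣ N j₂) : ¬ Lucky p N a' := by
  rintro ⟨j₀, e₀, -, -, -, hrest⟩
  have key : ∀ j, j ≠ j₀ → (p : ℤ) ∣ N j := fun j hj =>
    (dvd_pow_self (p : ℤ) (Nat.succ_ne_zero e₀)).trans (hrest j hj).1
  by_cases hj₁ : j₁ = j₀
  · exact h₂ (key j₂ (fun h => hne (hj₁.trans h.symm)))
  · exact h₁ (key j₁ hj₁)

/-- The residues modulo `5` of the CONTINUANTS `q_n` of the control slope `γ = [0; 3, 1, 1, 1, …]` of the g31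
registry (`q₀ = 1`, `q₁ = 3`, `q_{n+2} = q_{n+1} + q_n`; these are the Lucas numbers `L_{n+1} = F_{n+2} + F_n`)
cycle through `1, 3, 4, 2` — never `0`. [folklore] -/
theorem lucas_mod_five (n : ℕ) :
    ((Nat.fib (n + 2) + Nat.fib n) % 5 = 1 ∧ (Nat.fib (n + 3) + Nat.fib (n + 1)) % 5 = 3) ∨
    ((Nat.fib (n + 2) + Nat.fib n) % 5 = 3 ∧ (Nat.fib (n + 3) + Nat.fib (n + 1)) % 5 = 4) ∨
    ((Nat.fib (n + 2) + Nat.fib n) % 5 = 4 ∧ (Nat.fib (n + 3) + Nat.fib (n + 1)) % 5 = 2) ∨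
    ((Nat.fib (n + 2) + Nat.fib n) % 5 = 2 ∧ (Nat.fib (n + 3) + Nat.fib (n + 1)) % 5 = 1) := by
  induction n with
  | zero => decide
  | succ n ih =>
      have e1 : Nat.fib (n + 1 + 3) = Nat.fib (n + 2) + Nat.fib (n + 3) := Nat.fib_add_two
      have e2 : Nat.fib (n + 1 + 1) = Nat.fib n + Nat.fib (n + 1) := Nat.fib_add_two
      have e3 : Nat.fib (n + 1 + 2) = Nat.fib (n + 3) := rfl
      omega

/-- **CONTROL CERTIFICATE** (the `p`-UNLUCKY top of the g31 registry, `p = 5`, `γ = [0; 3, 1̄]`): `5` divides NO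
continuant of `γ`. [folklore] -/
theorem five_not_dvd_lucas (n : ℕ) : ¬ 5 ∣ Nat.fib (n + 2) + Nat.fib n := by
  rcases lucas_mod_five n with h | h | h | h <;> omega

/-- **THE CONTROL IN THE CELL'S LETTERS**: on every Perron chart of the `5`-unlucky rank-2 top the frame twists are
`(±q_n, ∓q_{n+1})` by consecutive continuants, both prime to `5`, so NO chart frame is lucky — the arithmetic clause
(L) of `WildLogDiagonalLUAbove` FAILS there at every depth although the binomial shape (T) holds at every depth; by
monomial-ideal principality no such chart is a pseudo-reflection model (the complement kind of the module
docstring §5). [folklore] -/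
theorem control_not_lucky (n : ℕ) (ε : ℤ) (hε : ε = 1 ∨ ε = -1) (a' : Fin 2 → ℕ) :
    ¬ Lucky 5 ![ε * (Nat.fib (n + 2) + Nat.fib n : ℕ), -ε * (Nat.fib (n + 3) + Nat.fib (n + 1) : ℕ)] a' := by
  have h5 : ∀ m : ℕ, ¬ 5 ∣ m → ∀ η : ℤ, (η = 1 ∨ η = -1) → ¬ ((5 : ℕ) : ℤ) ∣ η * (m : ℤ) := by
    intro m hm η hη hd
    have hd' : (5 : ℤ) ∣ (m : ℤ) := by
      rcases hη with rfl | rfl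
      · simpa using hd
      · simpa using hd
    exact hm (by exact_mod_cast hd')
  refine not_lucky_of_not_dvd_two 5 a' (j₁ := 0) (j₂ := 1) (by decide) ?_ ?_
  · simpa using h5 _ (five_not_dvd_lucas n) ε hε
  · have hε' : -ε = 1 ∨ -ε = -1 := by rcases hε with rfl | rfl <;> simp
    simpa using h5 _ (five_not_dvd_lucas (n + 1)) (-ε) hε'

end Control

section CutLD

open Summit.ResolutionOfSingularities.ResolutionOfSingularities.Theses
open Summit.ResolutionOfSingularities.ResolutionOfSingularities.Theorems
open Summit.ResolutionOfSingularities.ResolutionOfSingularities.Theorems.KeyChainLU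
open Summit.ResolutionOfSingularities.ResolutionOfSingularities.Theorems.HenselKeyChainLU
open Summit.ResolutionOfSingularities.ResolutionOfSingularities.Theorems.GaloisDescentLU
open Summit.ResolutionOfSingularities.ResolutionOfSingularities.Theorems.PfaffLine
open Summit.ResolutionOfSingularities.ResolutionOfSingularities.Theorems.ToricLadder
open Summit.ResolutionOfSingularities.ResolutionOfSingularities.Theorems.KaplanskyLadder
open Summit.ResolutionOfSingularities.ResolutionOfSingularities.Theorems.PerronLadder
open Summit.ResolutionOfSingularities.ResolutionOfSingularities.Theorems.DefectlessLadder
open Summit.ResolutionOfSingularities.ResolutionOfSingularities.Theorems.WCut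
open Summit.ResolutionOfSingularities.ResolutionOfSingularities.Theorems.TameQuotientLU
open Summit.ResolutionOfSingularities.ResolutionOfSingularities.Theorems.DecompositionDescentLU
open Summit.ResolutionOfSingularities.ResolutionOfSingularities.Theorems.InertDescentLU
open Summit.ResolutionOfSingularities.ResolutionOfSingularities.Theorems.TameInertialLU
open Summit.ResolutionOfSingularities.ResolutionOfSingularities.Theorems.TameTwoStoreyLU
open Summit.ResolutionOfSingularities.ResolutionOfSingularities.Theorems.MonomialBlowupLU
open Summit.ResolutionOfSingularities.ResolutionOfSingularities.Theorems.WildReflectionLU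

variable {k : Type} [Field k] {K : Type} [Field K] [Algebra k K]

/-- OFF the wild pseudo-reflection cell nothing of the binomial log-diagonal kind is left (the production law):
`¬ WildPseudoReflectionLUAbove → ¬ WildLogDiagonalLUAbove`. [folklore] -/
theorem not_wildLogDiagonalLUAbove_of_not_wildPseudoReflectionLUAbove {O : ValuationSubring K}
    (h : ¬ WildPseudoReflectionLUAbove k O) : ¬ WildLogDiagonalLUAbove k O :=
  fun hL => h (wildPseudoReflectionLUAbove_of_wildLogDiagonalLUAbove hL)

/-- … hence off the residue-free-witness cell too (honest reading of the cut below: the CLASS of places of `R33` is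
the class of `R32` and of `R31`; what is new is the PRODUCTION MECHANISM deciding a typed wild kind). [folklore] -/
theorem not_wildLogDiagonalLUAbove_of_not_unramifiedWitnessLUAbove {O : ValuationSubring K}
    (h : ¬ UnramifiedWitnessLUAbove k O) : ¬ WildLogDiagonalLUAbove k O :=
  not_wildLogDiagonalLUAbove_of_not_wildPseudoReflectionLUAbove
    (not_wildPseudoReflectionLUAbove_of_not_unramifiedWitnessLUAbove h)

/-- The BINOMIAL LOG-DIAGONAL CELL PIECE of the residual family (tag DECIDED by `relLU_of_wildLogDiagonalLUAbove`):
R32's binders together with the cell give relative local uniformization. -/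
def NonKHToricArchLUKeyHenselDescentQuotTInertTwoMBWildLDCell (e c n : ℕ) : Prop :=
  ∀ p : ℕ, p.Prime → ∀ (k K : Type) [Field k] [CharP k p] [Field K] [Algebra k K],
    Algebra.trdeg k K ≤ n → ∀ O : ValuationSubring K, Nonempty O.valuation.RankOne →
    (∀ y ∈ O, ∃ f : Polynomial k, f ≠ 0 ∧ Polynomial.aeval y f ∈ O.nonunits) →
    ¬ IsAbhyankarPlace O (algebraMap k K).fieldRange ⊤ →
    ¬ (∃ d : ℕ, d < n ∧ SepDenseBelow k O d) → ¬ ToricDenseBelow k O e → ¬ KHTopBelow k O c →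
    ¬ KeyChainTopBelow k O → ¬ HenselKeyChainTopBelow k O → ¬ GaloisHenselDescentDatum k O →
    ¬ TameQuotientLU.TameEquivariantLUAbove k O →
    ¬ DecompositionFieldLUAbove k O → ¬ DecWitnessLUAbove k O → ¬ UnramifiedWitnessLUAbove k O →
    ¬ TameInertialLUAbove k O → ¬ TameOverInertLUAbove k O → ¬ MonomialBlowupAbove k O →
    ¬ WildPseudoReflectionLUAbove k O →
    WildLogDiagonalLUAbove k O → RelLocalUniformization k K O

/-- THE LAW DECIDES THE CELL PIECE outright (no port, no fact binder, every `d`, every `p`). [folklore] -/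
theorem nonKHToricArchLUKeyHenselDescentQuotTInertTwoMBWildLDCell_holds (e c n : ℕ) :
    NonKHToricArchLUKeyHenselDescentQuotTInertTwoMBWildLDCell e c n :=
  fun _ _ _ _ _ _ _ _ _ _ _ _ _ _ _ _ _ _ _ _ _ _ _ _ _ _ _ hL => relLU_of_wildLogDiagonalLUAbove hL

/-- **NEW LOCATED RESIDUAL `R33`** (tag UNDECIDED · WEAKER than the root · located at `(e, c, n) = (3, 3, 4)`): the
located residual OFF the key-chain, Hensel, descent, tame-quotient, decomposition-descent, residue-free witness,
tame-inertial, two-storey, monomial-blow-up, wild-pseudo-reflection AND BINOMIAL-LOG-DIAGONAL cells — in addition to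
R32's clauses, for NO Galois `ℤ/p`-layer `K′/K` (`p = char k`) with `G`-stable `O′` and residues in `k` does every
f.g. birational model `R ⊆ O` admit above it a `G`-stable regular f.g. model carrying a FRAME on which a generator
acts BINOMIALLY LOG-DIAGONALLY (`g x′_j = x′_j (1 + η)^{N_j}`, `η` a frame monomial up to a unit) with `p`-LUCKY
twists.  KIND CONSUMED hypothesis-free, in EVERY dimension and every characteristic, by the PRODUCTION law
`relLU_of_wildLogDiagonalLUAbove` (toric chart + Frobenius normal form + Nakayama + derivation rule PRODUCE the
pseudo-reflection model `ι(R)[t₀, x′, (1 + gⁱη)⁻¹]` with generator `x′_{j₀}`; then [KiralyLutkebohmert2013, Thm. 2]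
through the g31 law, by name).  HONEST SCOPE OF THE CUT: the extra binder `¬ WildLogDiagonalLUAbove k O` is IMPLIED by
R32's `¬ WildPseudoReflectionLUAbove k O` (`not_wildLogDiagonalLUAbove_of_not_wildPseudoReflectionLUAbove`), hence by
R31's `¬ UnramifiedWitnessLUAbove k O`: the CLASS of places of R33 is the class of R32 (= of R31) — what is new is not
a class of places but the MECHANISM: a typed wild kind with NO regularity / principality surrogate on the model side is
decided by producing the chart.  HONEST LOCATED REMAINDER inside the log-diagonal world (which `O` remain): (λ′) the
BINOMIAL-but-UNLUCKY tops — binomial shape on cofinal frames, `Lucky` false on every monomial chart (the registry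
control `p = 5`, `γ = [0; 3, 1̄]`: `control_not_lucky`, `five_not_dvd_lucas`); there NO monomial chart is a
pseudo-reflection model (monomial-ideal principality) and by [KiralyLutkebohmert2013, Thm. 2 (d) ⇒ (a)] no monomial
chart has a regular quotient: a law must either produce a pseudo-reflection model by a NON-monomial modification or
resolve the singular quotient of an unlucky chart downstairs (`d = 2`: Lipman; `d = 3`: the floor
[CossartPiltant2019]; `d ≥ 4`: OPEN) — IDEA-NEEDED, not claimed (RelLU holds there by Π₀ when the place is
Abhyankar, but such places are off the residual anyway); (λ″) MIXED-UNIT log-diagonal tops (`g xᵢ = xᵢ uᵢ` with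
units not powers of one principal unit: the augmentation of a chart monomial `x^c (u^c − 1)` has no `p`-adic normal
form — e.g. `(1+η)^{p−1}(1+η+η²x₃) − 1` has initial form `η² x₃`); (β′) isolated fixed points / moderately ramified
actions (Lorenzini–Schröer Def. 6.9 / Thm. 6.10; invariants singular by purity), (β″) non-cyclic `p`-inertia, (γ) the
defect / immediate world, (B′), (α3′) — all as located in R32's docstring.
[cite: KiralyLutkebohmert2013, Thm. 2, Ex. 6, Conj. 10 (arXiv:1001.1945 numbering)]
[cite: LorenziniSchroer2019, Def. 6.9, Thm. 6.10, Rem. 6.20] [cite: CossartPiltant2008, Lemma 9.4] -/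
def NonKHToricArchLUKeyHenselDescentQuotTInertTwoMBWildLD (e c n : ℕ) : Prop :=
  ∀ p : ℕ, p.Prime → ∀ (k K : Type) [Field k] [CharP k p] [Field K] [Algebra k K],
    Algebra.trdeg k K ≤ n → ∀ O : ValuationSubring K, Nonempty O.valuation.RankOne →
    (∀ y ∈ O, ∃ f : Polynomial k, f ≠ 0 ∧ Polynomial.aeval y f ∈ O.nonunits) →
    ¬ IsAbhyankarPlace O (algebraMap k K).fieldRange ⊤ →
    ¬ (∃ d : ℕ, d < n ∧ SepDenseBelow k O d) → ¬ ToricDenseBelow k O e → ¬ KHTopBelow k O c →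
    ¬ KeyChainTopBelow k O → ¬ HenselKeyChainTopBelow k O → ¬ GaloisHenselDescentDatum k O →
    ¬ TameQuotientLU.TameEquivariantLUAbove k O →
    ¬ DecompositionFieldLUAbove k O → ¬ DecWitnessLUAbove k O → ¬ UnramifiedWitnessLUAbove k O →
    ¬ TameInertialLUAbove k O → ¬ TameOverInertLUAbove k O → ¬ MonomialBlowupAbove k O →
    ¬ WildPseudoReflectionLUAbove k O → ¬ WildLogDiagonalLUAbove k O → RelLocalUniformization k K O

/-- Dropping the negated log-diagonal hypothesis: `R32 → R33`. [folklore] -/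
theorem nonKHToricArchLUKeyHenselDescentQuotTInertTwoMBWildLD_of_wild {e c n : ℕ}
    (h : NonKHToricArchLUKeyHenselDescentQuotTInertTwoMBWild e c n) :
    NonKHToricArchLUKeyHenselDescentQuotTInertTwoMBWildLD e c n :=
  fun p hp k K _ _ _ _ hd O h1 h0 hA hnd hnt hnk hkey hH hG hT hDF hDW hU hI h2 hMB hW _ =>
    h p hp k K hd O h1 h0 hA hnd hnt hnk hkey hH hG hT hDF hDW hU hI h2 hMB hW

/-- **THE LOG-DIAGONAL CUT** (kernel, exact, hypothesis-free): the g31 located residual `R32` is EQUIVALENT to its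
part off the binomial log-diagonal cell — on the cell the production law `relLU_of_wildLogDiagonalLUAbove` decides
(case split on `WildLogDiagonalLUAbove k O`). [folklore] -/
theorem nonKHToricArchLUKeyHenselDescentQuotTInertTwoMBWild_iff_logDiag {e c n : ℕ} :
    NonKHToricArchLUKeyHenselDescentQuotTInertTwoMBWild e c n ↔
      NonKHToricArchLUKeyHenselDescentQuotTInertTwoMBWildLD e c n := by
  refine ⟨nonKHToricArchLUKeyHenselDescentQuotTInertTwoMBWildLD_of_wild,
    fun h p hp k K _ _ _ _ hd O hr hz hA hnd hnt hnk hkey hH hG hT hDF hDW hU hI h2 hMB hW => ?_⟩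
  by_cases hL : WildLogDiagonalLUAbove k O
  · exact relLU_of_wildLogDiagonalLUAbove hL
  exact h p hp k K hd O hr hz hA hnd hnt hnk hkey hH hG hT hDF hDW hU hI h2 hMB hW hL

/-- The same cut WITHOUT a case split: R33's extra binder is implied by R32's `¬ WildPseudoReflectionLUAbove`
(`not_wildLogDiagonalLUAbove_of_not_wildPseudoReflectionLUAbove`) — the honest reading of the cut. [folklore] -/
theorem nonKHToricArchLUKeyHenselDescentQuotTInertTwoMBWild_of_logDiag {e c n : ℕ}
    (h : NonKHToricArchLUKeyHenselDescentQuotTInertTwoMBWildLD e c n) :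
    NonKHToricArchLUKeyHenselDescentQuotTInertTwoMBWild e c n :=
  fun p hp k K _ _ _ _ hd O hr hz hA hnd hnt hnk hkey hH hG hT hDF hDW hU hI h2 hMB hW =>
    h p hp k K hd O hr hz hA hnd hnt hnk hkey hH hG hT hDF hDW hU hI h2 hMB hW
      (not_wildLogDiagonalLUAbove_of_not_wildPseudoReflectionLUAbove hW)

/-- The EXACT re-location at the programme's parameters `(3, 3, 4)` (`R32 ↔ R33`, hypothesis-free). [folklore] -/
theorem nonKHToricArchLUKeyHenselDescentQuotTInertTwoMBWild334_iff_logDiag :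
    NonKHToricArchLUKeyHenselDescentQuotTInertTwoMBWild 3 3 4 ↔
      NonKHToricArchLUKeyHenselDescentQuotTInertTwoMBWildLD 3 3 4 :=
  nonKHToricArchLUKeyHenselDescentQuotTInertTwoMBWild_iff_logDiag

/-- The g30 located residual `R31` re-located in one step (`R31 ↔ R33`). [folklore] -/
theorem nonKHToricArchLUKeyHenselDescentQuotTInertTwoMB_iff_logDiag {e c n : ℕ} :
    NonKHToricArchLUKeyHenselDescentQuotTInertTwoMB e c n ↔
      NonKHToricArchLUKeyHenselDescentQuotTInertTwoMBWildLD e c n :=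
  nonKHToricArchLUKeyHenselDescentQuotTInertTwoMB_iff_wild.trans
    nonKHToricArchLUKeyHenselDescentQuotTInertTwoMBWild_iff_logDiag

/-- The g29 located residual `R30` re-located (`R30 ↔ R33`). [folklore] -/
theorem nonKHToricArchLUKeyHenselDescentQuotTInertTwo_iff_logDiag {e c n : ℕ} :
    NonKHToricArchLUKeyHenselDescentQuotTInertTwo e c n ↔
      NonKHToricArchLUKeyHenselDescentQuotTInertTwoMBWildLD e c n :=
  nonKHToricArchLUKeyHenselDescentQuotTInertTwo_iff_wild.trans
    nonKHToricArchLUKeyHenselDescentQuotTInertTwoMBWild_iff_logDiag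

/-- The g28 located residual `R29` re-located (`R29 ↔ R33`). [folklore] -/
theorem nonKHToricArchLUKeyHenselDescentQuotTInert_iff_logDiag {e c n : ℕ} :
    NonKHToricArchLUKeyHenselDescentQuotTInert e c n ↔
      NonKHToricArchLUKeyHenselDescentQuotTInertTwoMBWildLD e c n :=
  nonKHToricArchLUKeyHenselDescentQuotTInert_iff_wild.trans
    nonKHToricArchLUKeyHenselDescentQuotTInertTwoMBWild_iff_logDiag

/-- The g28 located residual `R28` re-located (`R28 ↔ R33`). [folklore] -/
theorem nonKHToricArchLUKeyHenselDescentQuotInert_iff_logDiag {e c n : ℕ} :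
    NonKHToricArchLUKeyHenselDescentQuotInert e c n ↔
      NonKHToricArchLUKeyHenselDescentQuotTInertTwoMBWildLD e c n :=
  nonKHToricArchLUKeyHenselDescentQuotInert_iff_wild.trans
    nonKHToricArchLUKeyHenselDescentQuotTInertTwoMBWild_iff_logDiag

/-- The g25 located residual re-located (`R25 ↔ R33`). [folklore] -/
theorem nonKHToricArchLUKeyHenselDescentQuot_iff_logDiag {e c n : ℕ} :
    NonKHToricArchLUKeyHenselDescentQuot e c n ↔ NonKHToricArchLUKeyHenselDescentQuotTInertTwoMBWildLD e c n :=
  nonKHToricArchLUKeyHenselDescentQuot_iff_wild.trans nonKHToricArchLUKeyHenselDescentQuotTInertTwoMBWild_iff_logDiag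

/-- The g23 located residual re-located (`R23 ↔ R33`). [folklore] -/
theorem nonKHToricArchLUKeyHenselDescent_iff_logDiag {e c n : ℕ} :
    NonKHToricArchLUKeyHenselDescent e c n ↔ NonKHToricArchLUKeyHenselDescentQuotTInertTwoMBWildLD e c n :=
  nonKHToricArchLUKeyHenselDescent_iff_wild.trans nonKHToricArchLUKeyHenselDescentQuotTInertTwoMBWild_iff_logDiag

/-- The TRUE residual family of g17/g20 (`NonKHToricArchLU`) re-located off all eleven cells. [folklore] -/
theorem nonKHToricArchLU_iff_logDiag {e c n : ℕ} :
    NonKHToricArchLU e c n ↔ NonKHToricArchLUKeyHenselDescentQuotTInertTwoMBWildLD e c n :=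
  nonKHToricArchLU_iff_wild.trans nonKHToricArchLUKeyHenselDescentQuotTInertTwoMBWild_iff_logDiag

/-- The new residual follows from the root outright (it is a WEAKER piece). [folklore] -/
theorem nonKHToricArchLUKeyHenselDescentQuotTInertTwoMBWildLD_of_root (hS : _root_.ResolutionOfSingularities)
    (e c n : ℕ) : NonKHToricArchLUKeyHenselDescentQuotTInertTwoMBWildLD e c n :=
  nonKHToricArchLUKeyHenselDescentQuotTInertTwoMBWildLD_of_wild
    (nonKHToricArchLUKeyHenselDescentQuotTInertTwoMBWild_of_root hS e c n)

/-- **`closes_logDiag` — ROOT BY NAME (binders PRINTED, = `closes_mb`'s / `closes_wild`'s with `R32 ↦ R33`):**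
`(hCP : CossartPiltant2019LU3)` the Cossart–Piltant dimension-3 floor (print) ·
`(hCJS : CossartJannsenSaito2020Embedded)` embedded resolution of excellent surfaces (named fact) ·
`(hAsc : KK05NCVAscent)` the Knaf–Kuhlmann (NC)+(V) ascent Π₁ (print) · `(hN : ∀ d ≥ 4, R33 3 3 d)` the located
residual OFF the key-chain, Hensel, descent, tame-quotient, decomposition-descent, residue-free witness,
tame-inertial, two-storey, monomial-blow-up, wild-pseudo-reflection AND binomial-log-diagonal cells ·
`(h₃ : Valuative.PatchingRel)` the patching crux 0642 ⇒ `ResolutionOfSingularities`.  All eleven cells are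
discharged INSIDE the kernel. [folklore] -/
theorem closes_logDiag (hCP : CossartPiltant2019LU3.{0}) (hCJS : CossartJannsenSaito2020Embedded.{0})
    (hAsc : KK05NCVAscent) (hN : ∀ d, 4 ≤ d → NonKHToricArchLUKeyHenselDescentQuotTInertTwoMBWildLD 3 3 d)
    (h₃ : Valuative.PatchingRel) : _root_.ResolutionOfSingularities :=
  closes_wild hCP hCJS hAsc
    (fun d hd => nonKHToricArchLUKeyHenselDescentQuotTInertTwoMBWild_iff_logDiag.2 (hN d hd)) h₃

/-- Root-level summary: modulo floor + CJS + Π₁ + 0642 the ROOT is EQUIVALENT to the residual family off the eleven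
cells. [folklore] -/
theorem root_iff_logDiag_sigma (hCP : CossartPiltant2019LU3.{0})
    (hCJS : CossartJannsenSaito2020Embedded.{0}) (hAsc : KK05NCVAscent) (h₃ : Valuative.PatchingRel) :
    _root_.ResolutionOfSingularities ↔
      ∀ d, 4 ≤ d → NonKHToricArchLUKeyHenselDescentQuotTInertTwoMBWildLD 3 3 d := by
  rw [root_iff_wild_sigma hCP hCJS hAsc h₃]
  exact forall₂_congr fun d _ => nonKHToricArchLUKeyHenselDescentQuotTInertTwoMBWild_iff_logDiag

end CutLD

end Summit.ResolutionOfSingularities.ResolutionOfSingularities.Theorems.WildLogDiagonalLU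

end
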